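import Summits.AnomalousDissipation.AnomalousDissipation.Theorems.SolenoidalFractalHomogenisationLagrangianStepFrameTransport
import Literature.Analysis.FluidPDE.PassiveVectorTensorFourier
import HarnessLib

/-!
# K1L_D (stmt-AnomalousDissipation-27980), line «onelevel-design», brick Z6-E: the EDDY TERM of the window cross density IN THE FRAME
# of the coarse window flow (helper; `--supports … --as helper`; lead-k1l-onelevel-p1 g4)

Companion of `…LagrangianStepFrameTransport` (Z6-T, p688356).  The eddy term of the Z1-op cross density
(`…WindowDualityE.inner_sub_eq_setIntegral_cross_level_eddy`) at time `σ` is `Σ'ₖ 4π² ⟪ŵ(k), T_𝔼(k) ψ̂(k)⟫_ℂ`, `T_𝔼(k)` the symbol of the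
constant eddy tensor `𝔼` (`symbT`).  This file gives

* `hasSum_eddy_fourier` — Fourier ↔ physical (generic `𝕋^d`): for `w, ψ ∈ L²` with weak gradients `gʷ, g^ψ ∈ L²`,
  `Σ'ₖ 4π² ⟪ŵ(k), T_𝔸(k) ψ̂(k)⟫_ℂ = ∫ Σ_{i a j b} 𝔸ᵢₐⱼᵦ (gʷₐ)ⱼ (g^ψᵦ)ᵢ` (componentwise Parseval + `ĝₐ(k) = 2πikₐ f̂(k)`);
* `eq_sum_inv_smul_of_isUnit_det`, `isUnit_det_flowDeriv`, `comp_X_eq_sum_inv_smul_frameDeriv` — the inverse-Jacobian algebra on a refresh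
  window: `gₐ(X y) = Σ_c (J(y)⁻¹)_{ca} • G_c(y)` where `G_c = Σₐ' J_{a'c} • gₐ'∘X` is the frame gradient (the weak gradient of `ψ∘X`, Z5) and
  `J_{ac}(y) = (DX(y) e_c)ₐ`, `det J = 1` (K3L's `LevelRegular.det_flowDeriv_eq_one`);
* **`tsum_eddy_frame_of`**, **`tsum_eddy_frame`** — Z6-E: the eddy term equals `∫ Σ 𝔸ᵢₐⱼᵦ (Γʷₐ y)ⱼ (Γ^ψᵦ y)ᵢ dy` for ANY frame representatives
  `Γₐ(y) = gₐ(X y)` (measure preservation), in particular for `Γₐ = Σ_c (J⁻¹)_{ca} • G_c` — the eddy pairing of the frame gradients through the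
  pulled-back tensor (memo L8 §2: "viscous term `= ∫(∇w̃ J⁻¹):𝔼:(∇ψ̃ J⁻¹)`").

NOT a proof of §9z, of the crux, or of AD; rung F-D1.A0.
-/

set_option linter.dupNamespace false  -- the summit-side namespace `Summit.AnomalousDissipation.AnomalousDissipation.…` repeats a component by design (D-0017)

noncomputable section

namespace Summit.AnomalousDissipation.AnomalousDissipation.Theorems.SolenoidalFractalHomogenisation.LagrangianStep.FrameForm

open Literature.Analysis Literature.Analysis.FluidPDE Literature.Analysis.FluidPDE.Torus Literature.Analysis.FunctionSpaces
  Literature.Analysis.FunctionSpaces.Torus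
open MeasureTheory Set Filter UnitAddTorus Function
open scoped ENNReal NNReal InnerProductSpace
open Literature.Analysis.FluidPDE.LatticeShear (LagrangianLatticeCarrier FractalCarrierData)

/-! ## §1 Fourier coefficients of weak derivatives (private copies, complexified; as in `…FrameTransport`) -/

section Coefficients

variable {d : Type*} [Fintype d] [DecidableEq d] {F : Type*} [NormedAddCommGroup F] [NormedSpace ℂ F]

omit [DecidableEq d] in
/-- `∫ ψ • h = ∫ (Re ψ) • h + i ∫ (Im ψ) • h` for smooth `ψ : 𝕋^d → ℂ` and integrable `h`.
-- adapted from `Literature/Analysis/FluidPDE/LagrangianLatticeCarrierFrameChainRule.lean` (private there) -/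
private theorem integral_smul_eq_re_add_I_smul_im₇ {ψ : UnitAddTorus d → ℂ} (hψ : IsSmooth ψ)
    {h : UnitAddTorus d → F} (hh : Integrable h volume) :
    ∫ x, ψ x • h x = (∫ x, (ψ x).re • h x) + Complex.I • ∫ x, (ψ x).im • h x := by
  have hre : IsSmooth fun x => (ψ x).re := hψ.comp_clm Complex.reCLM
  have him : IsSmooth fun x => (ψ x).im := hψ.comp_clm Complex.imCLM
  have h2i : Integrable (fun x => Complex.I • ((ψ x).im • h x)) volume :=
    (him.integrable_smul hh).smul Complex.I
  rw [← integral_smul, ← integral_add (hre.integrable_smul hh) h2i]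
  refine integral_congr_ae (ae_of_all _ fun x => ?_)
  beta_reduce
  calc ψ x • h x = (((ψ x).re : ℂ) + ((ψ x).im : ℂ) * Complex.I) • h x := by rw [Complex.re_add_im]
    _ = ((ψ x).re : ℂ) • h x + Complex.I • (((ψ x).im : ℂ) • h x) := by
        rw [add_smul, mul_comm, mul_smul]
    _ = (ψ x).re • h x + Complex.I • ((ψ x).im • h x) := by
        rw [Complex.coe_smul, Complex.coe_smul]

/-- `ĝ(n) = 2πi nᵢ f̂(n)` for a weak `i`-th partial derivative `g` of `f` (both integrable, complex values).
-- adapted from `Literature/Analysis/FluidPDE/LagrangianLatticeCarrierFrameChainRule.lean` (private there) -/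
private theorem mFourierCoeff_eq_of_hasWeakPartialDeriv₇ {i : d} {f g : UnitAddTorus d → F}
    (hf : Integrable f volume) (hg : Integrable g volume) (h : HasWeakPartialDeriv i f g)
    (n : d → ℤ) :
    mFourierCoeff g n = (2 * Real.pi * Complex.I * (n i)) • mFourierCoeff f n := by
  have hχ : IsSmooth (⇑(mFourier (-n)) : UnitAddTorus d → ℂ) := isSmooth_mFourier (-n)
  have hre : IsSmooth fun y => (mFourier (-n) y).re := hχ.comp_clm Complex.reCLM
  have him : IsSmooth fun y => (mFourier (-n) y).im := hχ.comp_clm Complex.imCLM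
  set c : ℂ := 2 * Real.pi * Complex.I * ((-n) i) with hc
  have hcχ : IsSmooth (fun x => c * mFourier (-n) x) := contDiff_const.mul hχ
  have hdre : ∀ x, partialDeriv i (fun y => (mFourier (-n) y).re) x = (c * mFourier (-n) x).re :=
    fun x => by
    have h1 := partialDeriv_clm_comp hχ Complex.reCLM i x
    rw [partialDeriv_mFourier] at h1
    exact h1
  have hdim : ∀ x, partialDeriv i (fun y => (mFourier (-n) y).im) x = (c * mFourier (-n) x).im :=
    fun x => by
    have h1 := partialDeriv_clm_comp hχ Complex.imCLM i x
    rw [partialDeriv_mFourier] at h1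
    exact h1
  have h1 := h (fun y => (mFourier (-n) y).re) hre
  have h2 := h (fun y => (mFourier (-n) y).im) him
  beta_reduce at h1 h2
  simp_rw [hdre] at h1
  simp_rw [hdim] at h2
  have h1' : ∫ x, (mFourier (-n) x).re • g x = -∫ x, (c * mFourier (-n) x).re • f x := by
    rw [h1, neg_neg]
  have h2' : ∫ x, (mFourier (-n) x).im • g x = -∫ x, (c * mFourier (-n) x).im • f x := by
    rw [h2, neg_neg]
  calc mFourierCoeff g n = ∫ x, mFourier (-n) x • g x := mFourierCoeff_eq_integral_volume g n
    _ = (∫ x, (mFourier (-n) x).re • g x) + Complex.I • ∫ x, (mFourier (-n) x).im • g x :=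
        integral_smul_eq_re_add_I_smul_im₇ hχ hg
    _ = -((∫ x, (c * mFourier (-n) x).re • f x) +
          Complex.I • ∫ x, (c * mFourier (-n) x).im • f x) := by
        rw [h1', h2', smul_neg, neg_add]
    _ = -∫ x, (c * mFourier (-n) x) • f x := by rw [integral_smul_eq_re_add_I_smul_im₇ hcχ hf]
    _ = -(c • mFourierCoeff f n) := by
        rw [mFourierCoeff_eq_integral_volume, ← integral_smul]
        congr 1
        refine integral_congr_ae (ae_of_all _ fun x => ?_)
        simp only [smul_smul]
    _ = (2 * Real.pi * Complex.I * (n i)) • mFourierCoeff f n := by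
        rw [← neg_smul]
        congr 1
        simp only [hc, Pi.neg_apply, Int.cast_neg]
        ring

/-- Components of the Fourier coefficients of a weak derivative of a real vector field:
`𝓕(complexify ∘ g)(n)ⱼ = 2πi nᵢ · 𝓕(complexify ∘ f)(n)ⱼ`. -/
private theorem mFourierCoeff_complexify_apply_eq_of_hasWeakPartialDeriv₇ {i : d}
    {f g : UnitAddTorus d → EuclideanSpace ℝ d} (hf : Integrable f volume) (hg : Integrable g volume)
    (h : HasWeakPartialDeriv i f g) (n : d → ℤ) (j : d) :
    (mFourierCoeff (EuclideanSpace.complexify ∘ g) n) j =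
      (2 * Real.pi * Complex.I * (n i)) * (mFourierCoeff (EuclideanSpace.complexify ∘ f) n) j := by
  have hf' : Integrable (EuclideanSpace.complexify ∘ f) volume :=
    EuclideanSpace.complexify.toContinuousLinearMap.integrable_comp hf
  have hg' : Integrable (EuclideanSpace.complexify ∘ g) volume :=
    EuclideanSpace.complexify.toContinuousLinearMap.integrable_comp hg
  have hc : HasWeakPartialDeriv i (EuclideanSpace.complexify ∘ f) (EuclideanSpace.complexify ∘ g) := by
    intro φ hφ
    have e1 : (fun x => partialDeriv i φ x • (EuclideanSpace.complexify ∘ f) x) =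
        fun x => EuclideanSpace.complexify (partialDeriv i φ x • f x) := by
      funext x
      simp only [Function.comp_apply, map_smul]
    have e2 : (fun x => φ x • (EuclideanSpace.complexify ∘ g) x) =
        fun x => EuclideanSpace.complexify (φ x • g x) := by
      funext x
      simp only [Function.comp_apply, map_smul]
    rw [e1, e2, LinearIsometry.integral_comp_comm, LinearIsometry.integral_comp_comm, h φ hφ, map_neg]
  rw [mFourierCoeff_eq_of_hasWeakPartialDeriv₇ hf' hg' hc n, PiLp.smul_apply, smul_eq_mul]

end Coefficients

/-! ## §2 The eddy pairing: Fourier form ↔ physical form (generic `𝕋^d`) -/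

section Generic

variable {d : Type*} [Fintype d] [DecidableEq d]

omit [DecidableEq d] in
/-- The algebra at one frequency: with `Gₐⱼ = 2πikₐ Xⱼ`, `G'ᵦᵢ = 2πikᵦ Yᵢ`,
`4π² ⟪X, T_𝔸(k) Y⟫_ℂ = Σ_{i a j b} 𝔸ᵢₐⱼᵦ · conj(Gₐⱼ) · G'ᵦᵢ`. -/
private theorem eddy_termwise₇ (𝔸 : Visc4 d) (k : d → ℤ) (X Y : EuclideanSpace ℂ d) (G G' : d → EuclideanSpace ℂ d)
    (hG : ∀ a j, G a j = (2 * Real.pi * Complex.I * (k a)) * X j) (hG' : ∀ b i, G' b i = (2 * Real.pi * Complex.I * (k b)) * Y i) :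
    ((4 * Real.pi ^ 2 : ℝ) : ℂ) * ⟪X, symbT 𝔸 k Y⟫_ℂ = ∑ i, ∑ a, ∑ j, ∑ b, (𝔸 i a j b : ℂ) * (starRingEnd ℂ (G a j) * G' b i) := by
  have hterm : ∀ i a j b, (𝔸 i a j b : ℂ) * (starRingEnd ℂ (G a j) * G' b i) =
      ((4 * Real.pi ^ 2 : ℝ) : ℂ) * (starRingEnd ℂ (X j) * (((𝔸 i a j b * (k a : ℝ) * (k b : ℝ) : ℝ) : ℂ) * Y i)) := by
    intro i a j b
    rw [hG, hG']
    simp only [map_mul, Complex.conj_I, Complex.conj_ofReal, map_intCast, map_ofNat]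
    push_cast
    linear_combination (-((𝔸 i a j b : ℂ) * (Real.pi : ℂ) ^ 2 * (k a : ℂ) * starRingEnd ℂ (X j) * (k b : ℂ) * Y i * 4)) * Complex.I_sq
  simp_rw [hterm]
  calc ((4 * Real.pi ^ 2 : ℝ) : ℂ) * ⟪X, symbT 𝔸 k Y⟫_ℂ
        = ∑ j, ∑ i, ∑ a, ∑ b, ((4 * Real.pi ^ 2 : ℝ) : ℂ) *
            (starRingEnd ℂ (X j) * (((𝔸 i a j b * (k a : ℝ) * (k b : ℝ) : ℝ) : ℂ) * Y i)) := by
          simp only [PiLp.inner_apply, RCLike.inner_apply', symbT_apply, Finset.mul_sum]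
    _ = ∑ i, ∑ j, ∑ a, ∑ b, ((4 * Real.pi ^ 2 : ℝ) : ℂ) *
            (starRingEnd ℂ (X j) * (((𝔸 i a j b * (k a : ℝ) * (k b : ℝ) : ℝ) : ℂ) * Y i)) := Finset.sum_comm
    _ = ∑ i, ∑ a, ∑ j, ∑ b, ((4 * Real.pi ^ 2 : ℝ) : ℂ) *
            (starRingEnd ℂ (X j) * (((𝔸 i a j b * (k a : ℝ) * (k b : ℝ) : ℝ) : ℂ) * Y i)) :=
          Finset.sum_congr rfl fun i _ => Finset.sum_comm

/-- **The eddy pairing, Fourier ↔ physical** (componentwise Parseval + `ĝₐ(k) = 2πikₐ f̂(k)`): for `w, ψ ∈ L²(𝕋^d; ℝ^d)` with weak partial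
derivatives `gʷₐ, g^ψₐ ∈ L²`,
`Σ'ₖ 4π² ⟪𝓕(complexify ∘ w)(k), T_𝔸(k) 𝓕(complexify ∘ ψ)(k)⟫_ℂ = Σ_{i a j b} 𝔸ᵢₐⱼᵦ ∫ (gʷₐ)ⱼ (g^ψᵦ)ᵢ` (as a `HasSum` in `ℂ`). -/
theorem hasSum_eddy_fourier (𝔸 : Visc4 d) {w ψ : UnitAddTorus d → EuclideanSpace ℝ d} {gw gψ : d → UnitAddTorus d → EuclideanSpace ℝ d}
    (hw : MemLp w 2 volume) (hψ : MemLp ψ 2 volume) (hgw : ∀ a, MemLp (gw a) 2 volume) (hgψ : ∀ a, MemLp (gψ a) 2 volume)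
    (hdw : ∀ a, HasWeakPartialDeriv a w (gw a)) (hdψ : ∀ a, HasWeakPartialDeriv a ψ (gψ a)) :
    HasSum (fun k : d → ℤ => ((4 * Real.pi ^ 2 : ℝ) : ℂ) *
        ⟪mFourierCoeff (EuclideanSpace.complexify ∘ w) k, symbT 𝔸 k (mFourierCoeff (EuclideanSpace.complexify ∘ ψ) k)⟫_ℂ)
      (((∑ i, ∑ a, ∑ j, ∑ b, 𝔸 i a j b * ∫ x, (gw a x) j * (gψ b x) i : ℝ) : ℂ)) := by
  have hwi : Integrable w volume := hw.integrable one_le_two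
  have hψi : Integrable ψ volume := hψ.integrable one_le_two
  have hgwi : ∀ a, Integrable (gw a) volume := fun a => (hgw a).integrable one_le_two
  have hgψi : ∀ a, Integrable (gψ a) volume := fun a => (hgψ a).integrable one_le_two
  have hGw : ∀ k a j, (mFourierCoeff (EuclideanSpace.complexify ∘ gw a) k) j =
      (2 * Real.pi * Complex.I * (k a)) * (mFourierCoeff (EuclideanSpace.complexify ∘ w) k) j := fun k a j =>
    mFourierCoeff_complexify_apply_eq_of_hasWeakPartialDeriv₇ hwi (hgwi a) (hdw a) k j
  have hGψ : ∀ k b i, (mFourierCoeff (EuclideanSpace.complexify ∘ gψ b) k) i =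
      (2 * Real.pi * Complex.I * (k b)) * (mFourierCoeff (EuclideanSpace.complexify ∘ ψ) k) i := fun k b i =>
    mFourierCoeff_complexify_apply_eq_of_hasWeakPartialDeriv₇ hψi (hgψi b) (hdψ b) k i
  -- componentwise Parseval
  have hP : ∀ i a j b, HasSum (fun k : d → ℤ => (𝔸 i a j b : ℂ) *
      (starRingEnd ℂ ((mFourierCoeff (EuclideanSpace.complexify ∘ gw a) k) j) * (mFourierCoeff (EuclideanSpace.complexify ∘ gψ b) k) i))
      ((𝔸 i a j b : ℂ) * ∫ x, starRingEnd ℂ (((gw a x) j : ℝ) : ℂ) * (((gψ b x) i : ℝ) : ℂ)) := by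
    intro i a j b
    have h := (hasSum_conj_mul_mFourierCoeff (memLp_ofReal_apply (hgw a) j) (memLp_ofReal_apply (hgψ b) i)).mul_left (𝔸 i a j b : ℂ)
    simp_rw [mFourierCoeff_complexify_apply (hgwi a), mFourierCoeff_complexify_apply (hgψi b)]
    exact h
  have e : (fun k : d → ℤ => ((4 * Real.pi ^ 2 : ℝ) : ℂ) *
        ⟪mFourierCoeff (EuclideanSpace.complexify ∘ w) k, symbT 𝔸 k (mFourierCoeff (EuclideanSpace.complexify ∘ ψ) k)⟫_ℂ) =
      fun k => ∑ i, ∑ a, ∑ j, ∑ b, (𝔸 i a j b : ℂ) *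
        (starRingEnd ℂ ((mFourierCoeff (EuclideanSpace.complexify ∘ gw a) k) j) *
          (mFourierCoeff (EuclideanSpace.complexify ∘ gψ b) k) i) :=
    funext fun k => eddy_termwise₇ 𝔸 k _ _ (fun a => mFourierCoeff (EuclideanSpace.complexify ∘ gw a) k)
      (fun b => mFourierCoeff (EuclideanSpace.complexify ∘ gψ b) k) (fun a j => hGw k a j) (fun b i => hGψ k b i)
  have hR : (((∑ i, ∑ a, ∑ j, ∑ b, 𝔸 i a j b * ∫ x, (gw a x) j * (gψ b x) i : ℝ) : ℂ)) =
      ∑ i, ∑ a, ∑ j, ∑ b, (𝔸 i a j b : ℂ) * ∫ x, starRingEnd ℂ (((gw a x) j : ℝ) : ℂ) * (((gψ b x) i : ℝ) : ℂ) := by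
    push_cast
    refine Finset.sum_congr rfl fun i _ => Finset.sum_congr rfl fun a _ => Finset.sum_congr rfl fun j _ =>
      Finset.sum_congr rfl fun b _ => ?_
    congr 1
    rw [← integral_complex_ofReal]
    refine integral_congr_ae (ae_of_all _ fun x => ?_)
    simp only [Complex.ofReal_mul, Complex.conj_ofReal]
  rw [e, hR]
  exact hasSum_sum fun i _ => hasSum_sum fun a _ => hasSum_sum fun j _ => hasSum_sum fun b _ => hP i a j b

end Generic

/-! ## §3 The inverse Jacobian of a window flow -/

/-- Linear algebra: for an invertible matrix `J`, `vₐ = Σ_c (J⁻¹)_{ca} • Σₐ' J_{a'c} • vₐ'` (`J · J⁻¹ = 1`). -/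
theorem eq_sum_inv_smul_of_isUnit_det {n : Type*} [Fintype n] [DecidableEq n] {V : Type*} [AddCommGroup V] [Module ℝ V]
    (J : Matrix n n ℝ) (hJ : IsUnit J.det) (v : n → V) (a : n) :
    v a = ∑ c, J⁻¹ c a • ∑ a', J a' c • v a' := by
  have h1 : ∀ a', ∑ c, J a' c * J⁻¹ c a = (1 : Matrix n n ℝ) a' a := fun a' => by
    rw [← Matrix.mul_apply, Matrix.mul_nonsing_inv J hJ]
  calc v a = ∑ a', (1 : Matrix n n ℝ) a' a • v a' := by
        simp only [Matrix.one_apply, ite_smul, one_smul, zero_smul, Finset.sum_ite_eq', Finset.mem_univ, if_true]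
    _ = ∑ a', (∑ c, J a' c * J⁻¹ c a) • v a' := by simp_rw [h1]
    _ = ∑ a', ∑ c, J⁻¹ c a • (J a' c • v a') := by
        simp_rw [Finset.sum_smul, smul_smul, mul_comm (J⁻¹ _ _)]
    _ = ∑ c, J⁻¹ c a • ∑ a', J a' c • v a' := by
        rw [Finset.sum_comm]
        simp_rw [Finset.smul_sum]

variable {k : ℕ}

/-- **`det DX = 1` on a refresh window, as invertibility**: for `t ∈ window (m+1) j'` the Jacobian matrix
`J_{ac}(y) = (E.flowDeriv m t (j'·refresh (m+1)) y e_c)ₐ` has unit determinant (K3L, `LevelRegular.det_flowDeriv_eq_one`). -/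
theorem isUnit_det_flowDeriv (E : LagrangianLatticeCarrier k) (hR : E.LevelRegular) (hL : E.IsLagrangian) (m : ℕ) (j' : ℤ) {t : ℝ}
    (ht : t ∈ E.window (m + 1) j') (y : UnitAddTorus (Fin 3)) :
    IsUnit (Matrix.of fun a c => (E.flowDeriv m t ((j' : ℝ) * E.refresh (m + 1)) y (EuclideanSpace.single c (1:ℝ))) a).det := by
  have h0 : (j' : ℝ) * E.refresh (m + 1) ≤ t := ht.1
  have h1 : t < ((j' : ℝ) + 1) * E.refresh (m + 1) := ht.2
  have hT : t - (j' : ℝ) * E.refresh (m + 1) < E.refresh (m + 1) := by linarith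
  have hs : t - (j' : ℝ) * E.refresh (m + 1) ∈ Icc 0 (t - (j' : ℝ) * E.refresh (m + 1)) := ⟨by linarith, le_rfl⟩
  have h := hR.det_flowDeriv_eq_one (hL m).1 j' hT hs y
  rw [show (j' : ℝ) * E.refresh (m + 1) + (t - (j' : ℝ) * E.refresh (m + 1)) = t by ring] at h
  rw [h]
  exact isUnit_one

/-- **Gradients at `X y` through the frame gradient**: for `t ∈ window (m+1) j'`, `X = E.X m t (j'·refresh)`, `J(y) = DX(y)`, any `g : Fin 3 → VF`:
`gₐ(X y) = Σ_c (J(y)⁻¹)_{ca} • G_c(y)` with `G_c(y) = Σₐ' (DX(y) e_c)ₐ' • gₐ'(X y)` (the weak gradient of `ψ ∘ X` when `g = ∇ψ`, Z5). -/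
theorem comp_X_eq_sum_inv_smul_frameDeriv (E : LagrangianLatticeCarrier k) (hR : E.LevelRegular) (hL : E.IsLagrangian) (m : ℕ) (j' : ℤ)
    {t : ℝ} (ht : t ∈ E.window (m + 1) j') (g : Fin 3 → VF) (y : UnitAddTorus (Fin 3)) (a : Fin 3) :
    g a (E.X m t ((j' : ℝ) * E.refresh (m + 1)) y) =
      ∑ c, (Matrix.of fun a c => (E.flowDeriv m t ((j' : ℝ) * E.refresh (m + 1)) y (EuclideanSpace.single c (1:ℝ))) a)⁻¹ c a •
        ∑ a', (E.flowDeriv m t ((j' : ℝ) * E.refresh (m + 1)) y (EuclideanSpace.single c (1:ℝ))) a' •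
          g a' (E.X m t ((j' : ℝ) * E.refresh (m + 1)) y) := by
  have h := eq_sum_inv_smul_of_isUnit_det _ (isUnit_det_flowDeriv E hR hL m j' ht y)
    (fun a' => g a' (E.X m t ((j' : ℝ) * E.refresh (m + 1)) y)) a
  simpa only [Matrix.of_apply] using h

/-! ## §4 The eddy term in the frame -/

/-- Change of variables for products of coordinates: `∫ f(X y)ⱼ g(X y)ᵢ dy = ∫ fⱼ gᵢ`. -/
theorem integral_coord_mul_comp_X (E : LagrangianLatticeCarrier k) (hR : E.LevelRegular) (m : ℕ) (t s : ℝ) {f g : VF}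
    (hf : AEStronglyMeasurable f volume) (hg : AEStronglyMeasurable g volume) (j i : Fin 3) :
    ∫ y, (f (E.X m t s y)) j * (g (E.X m t s y)) i = ∫ x, (f x) j * (g x) i :=
  integral_comp_X E hR m t s (g := fun x => (f x) j * (g x) i)
    (((PiLp.continuous_apply 2 _ j).comp_aestronglyMeasurable hf).mul ((PiLp.continuous_apply 2 _ i).comp_aestronglyMeasurable hg))

/-- **Z6-E, general form — the eddy term through ANY frame representatives of the gradients**: if `Γʷₐ(y) = gʷₐ(X y)` and
`Γ^ψᵦ(y) = g^ψᵦ(X y)` for the window flow `X = E.X m t s` (measure preserving), then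
`Σ'ₖ 4π² ⟪ŵ(k), T_𝔸(k) ψ̂(k)⟫_ℂ = Σ_{i a j b} 𝔸ᵢₐⱼᵦ ∫ (Γʷₐ y)ⱼ (Γ^ψᵦ y)ᵢ dy`. -/
theorem tsum_eddy_frame_of (E : LagrangianLatticeCarrier k) (hR : E.LevelRegular) (m : ℕ) (t s : ℝ) (𝔸 : Visc4 (Fin 3))
    {w ψ : VF} {gw gψ : Fin 3 → VF} (hw : MemLp w 2 volume) (hψ : MemLp ψ 2 volume)
    (hgw : ∀ a, MemLp (gw a) 2 volume) (hgψ : ∀ a, MemLp (gψ a) 2 volume)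
    (hdw : ∀ a, HasWeakPartialDeriv a w (gw a)) (hdψ : ∀ a, HasWeakPartialDeriv a ψ (gψ a))
    {Γw Γψ : Fin 3 → VF} (hΓw : ∀ a y, gw a (E.X m t s y) = Γw a y) (hΓψ : ∀ b y, gψ b (E.X m t s y) = Γψ b y) :
    ∑' k' : Fin 3 → ℤ, ((4 * Real.pi ^ 2 : ℝ) : ℂ) *
        ⟪mFourierCoeff (EuclideanSpace.complexify ∘ w) k', symbT 𝔸 k' (mFourierCoeff (EuclideanSpace.complexify ∘ ψ) k')⟫_ℂ =
      ((∑ i, ∑ a, ∑ j, ∑ b, 𝔸 i a j b * ∫ y, (Γw a y) j * (Γψ b y) i : ℝ) : ℂ) := by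
  rw [(hasSum_eddy_fourier 𝔸 hw hψ hgw hgψ hdw hdψ).tsum_eq]
  congr 1
  refine Finset.sum_congr rfl fun i _ => Finset.sum_congr rfl fun a _ => Finset.sum_congr rfl fun j _ =>
    Finset.sum_congr rfl fun b _ => ?_
  rw [← integral_coord_mul_comp_X E hR m t s (hgw a).1 (hgψ b).1 j i]
  simp only [hΓw, hΓψ]

/-- **Z6-E — the eddy term of the window cross density through the frame gradients and the inverse Jacobian.**  For a regular
Lagrangian carrier (`LevelRegular`, `IsLagrangian`), `t ∈ window (m+1) j'`, `X = E.X m t (j'·refresh (m+1))`, `J(y) = DX(y)`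
(`J_{ac} = (E.flowDeriv … y e_c)ₐ`, `det J = 1`), `w, ψ ∈ L²` with weak gradients `gʷ, g^ψ ∈ L²` and frame gradients
`Gʷ_c = Σₐ' J_{a'c} gʷₐ'∘X`, `G^ψ_c` likewise (the weak gradients of `w∘X`, `ψ∘X`, Z5 `frameChainRule`):
`Σ'ₖ 4π² ⟪ŵ(k), T_𝔸(k) ψ̂(k)⟫_ℂ = Σ_{i a j b} 𝔸ᵢₐⱼᵦ ∫ (Σ_c (J⁻¹)_{ca} Gʷ_c(y))ⱼ (Σ_c (J⁻¹)_{cb} G^ψ_c(y))ᵢ dy`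
("viscous term `= ∫ (∇w̃ J⁻¹) : 𝔸 : (∇ψ̃ J⁻¹)`", memo L8 §2). -/
theorem tsum_eddy_frame (E : LagrangianLatticeCarrier k) (hR : E.LevelRegular) (hL : E.IsLagrangian) (m : ℕ) (j' : ℤ) {t : ℝ}
    (ht : t ∈ E.window (m + 1) j') (𝔸 : Visc4 (Fin 3))
    {w ψ : VF} {gw gψ : Fin 3 → VF} (hw : MemLp w 2 volume) (hψ : MemLp ψ 2 volume)
    (hgw : ∀ a, MemLp (gw a) 2 volume) (hgψ : ∀ a, MemLp (gψ a) 2 volume)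
    (hdw : ∀ a, HasWeakPartialDeriv a w (gw a)) (hdψ : ∀ a, HasWeakPartialDeriv a ψ (gψ a)) :
    ∑' k' : Fin 3 → ℤ, ((4 * Real.pi ^ 2 : ℝ) : ℂ) *
        ⟪mFourierCoeff (EuclideanSpace.complexify ∘ w) k', symbT 𝔸 k' (mFourierCoeff (EuclideanSpace.complexify ∘ ψ) k')⟫_ℂ =
      ((∑ i, ∑ a, ∑ j, ∑ b, 𝔸 i a j b * ∫ y,
        (∑ c, (Matrix.of fun a c => (E.flowDeriv m t ((j' : ℝ) * E.refresh (m + 1)) y (EuclideanSpace.single c (1:ℝ))) a)⁻¹ c a •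
          ∑ a', (E.flowDeriv m t ((j' : ℝ) * E.refresh (m + 1)) y (EuclideanSpace.single c (1:ℝ))) a' •
            gw a' (E.X m t ((j' : ℝ) * E.refresh (m + 1)) y)) j *
        (∑ c, (Matrix.of fun a c => (E.flowDeriv m t ((j' : ℝ) * E.refresh (m + 1)) y (EuclideanSpace.single c (1:ℝ))) a)⁻¹ c b •
          ∑ a', (E.flowDeriv m t ((j' : ℝ) * E.refresh (m + 1)) y (EuclideanSpace.single c (1:ℝ))) a' •
            gψ a' (E.X m t ((j' : ℝ) * E.refresh (m + 1)) y)) i : ℝ) : ℂ) :=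
  tsum_eddy_frame_of E hR m t _ 𝔸 hw hψ hgw hgψ hdw hdψ
    (fun a y => comp_X_eq_sum_inv_smul_frameDeriv E hR hL m j' ht gw y a)
    (fun b y => comp_X_eq_sum_inv_smul_frameDeriv E hR hL m j' ht gψ y b)


end Summit.AnomalousDissipation.AnomalousDissipation.Theorems.SolenoidalFractalHomogenisation.LagrangianStep.FrameForm

end
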